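import Summits.ResolutionOfSingularities.ResolutionOfSingularities.Theorems.RadicialJungCleanModelsSufficeKummerOrderStructure
import Summits.ResolutionOfSingularities.ResolutionOfSingularities.Theorems.RadicialJungCleanModelsSufficeKummerOrderChart
import Mathlib

/-!
# Route `RadicialJung`, crux `CleanModelsSuffice`: the Kummer order over two charged components

Let `A` be a regular local ring with fraction field `K` of characteristic `p`, `L/K` of degree
`p`, `y ∈ L ∖ K` with `y^p = ∏_{i ≤ m} t_i^{a_i}` (`t_i ∈ A ∖ 0`, `a₀ = 1`, `1 ≤ a_i < p`), and
`R = ⊕_{j<p} A · z_j ⊆ L` the Kummer order (`z_j = y^j / ∏_i t_i^{⌊j a_i/p⌋}`; free, local and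
finite over `A` by `stub_kummerOrderStructure`). This file proves `stub_kummerOrderNotRegular`:
if `t₀ ∈ 𝔪_A` and `t_{i₁} ∈ 𝔪_A` for some `i₁ ≠ 0`, then `R` is NOT regular (the local algebra
behind "`V^L` is singular over a point on two charged boundary components", §0(b) of the game).

Proof. Let `ψ₀, ψ₁ : R → A` be the `z₀`- and `z₁`-coordinates of the basis `z₀ = 1, …, z_{p-1}`.
By the multiplication table `z_j z_k = (∏_i t_i^{e_i}) z_{(j+k) mod p}`,
`e_i = ⌊(j+k)a_i/p⌋ - ⌊j a_i/p⌋ - ⌊k a_i/p⌋`: `ψ₀(𝔪_R²) ⊆ 𝔪_A²` (the products with a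
`z₀`-component are `𝔪_A · 𝔪_A` and `z_j z_{p-j} = ∏ t_i^{e_i}`, all `e_i ≥ 1` as `p ∤ j a_i`, a
multiple of `t₀ t_{i₁} ∈ 𝔪_A²`) and `ψ₁(𝔪_R²) ⊆ 𝔪_A` (the products with a `z₁`-component are
`𝔪_A · z₁` and `z_j z_k`, `j + k = p + 1`, whose coefficient is a multiple of `t₀` as `a₀ = 1`).
Hence (`finrank_cotangentSpace_add_one_le_of_coord`) lifts of a basis of `𝔪_A/𝔪_A²` together
with `z₁` are linearly independent in `𝔪_R/𝔪_R²`: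
`edim R ≥ dim A + 1 > dim A ≥ dim R` (incomparability for the integral extension `A ⊆ R`).
-/

noncomputable section

set_option linter.dupNamespace false -- mandated namespace of this single-conjunct summit

namespace Summit.ResolutionOfSingularities.ResolutionOfSingularities.Theorems.RadicialJung.CleanModelsSuffice

open IsLocalRing

/-! ### An abstract lower bound for the embedding dimension of a local `A`-algebra -/

/-- **Embedding dimension grows by one.** Let `A → R` be local rings (`A`, `R` Noetherian) with
`𝔪_A R ⊆ 𝔪_R` and `R = A + 𝔪_R`, and let `φ₀, φ₁ : R → A` be `A`-linear with `φ₀ ∘ ι = id`,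
`φ₁ ∘ ι = 0` (`ι : A → R`), `φ₀(𝔪_R²) ⊆ 𝔪_A²`, `φ₁(𝔪_R²) ⊆ 𝔪_A`, and `w ∈ 𝔪_R` with `φ₀(w) = 0`,
`φ₁(w) = 1`. Then `dim_{κ_A} 𝔪_A/𝔪_A² + 1 ≤ dim_{κ_R} 𝔪_R/𝔪_R²`: lifts of a basis of `𝔪_A/𝔪_A²`
together with `w` are linearly independent in `𝔪_R/𝔪_R²`. [folklore] -/
theorem finrank_cotangentSpace_add_one_le_of_coord {A R : Type} [CommRing A] [IsLocalRing A]
    [IsNoetherianRing A] [CommRing R] [IsLocalRing R] [IsNoetherianRing R] [Algebra A R]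
    (hloc : ∀ b ∈ maximalIdeal A, algebraMap A R b ∈ maximalIdeal R)
    (hsur : ∀ r : R, ∃ b : A, r - algebraMap A R b ∈ maximalIdeal R)
    (φ₀ φ₁ : R →ₗ[A] A)
    (h00 : ∀ b, φ₀ (algebraMap A R b) = b) (h10 : ∀ b, φ₁ (algebraMap A R b) = 0)
    (w : R) (hw : w ∈ maximalIdeal R) (h0w : φ₀ w = 0) (h1w : φ₁ w = 1)
    (hmul0 : ∀ r ∈ maximalIdeal R, ∀ r' ∈ maximalIdeal R, φ₀ (r * r') ∈ maximalIdeal A ^ 2)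
    (hmul1 : ∀ r ∈ maximalIdeal R, ∀ r' ∈ maximalIdeal R, φ₁ (r * r') ∈ maximalIdeal A) :
    Module.finrank (ResidueField A) (CotangentSpace A) + 1 ≤
      Module.finrank (ResidueField R) (CotangentSpace R) := by
  classical
  set d := Module.finrank (ResidueField A) (CotangentSpace A)
  let bA := Module.finBasis (ResidueField A) (CotangentSpace A)
  choose x hx using fun i : Fin d => Ideal.toCotangent_surjective (maximalIdeal A) (bA i)
  -- `φ₀`, `φ₁` map `𝔪_R²` into `𝔪_A²`, `𝔪_A`
  have hφ : ∀ (φ : R →ₗ[A] A) (I : Ideal A),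
      (∀ r ∈ maximalIdeal R, ∀ r' ∈ maximalIdeal R, φ (r * r') ∈ I) →
        ∀ u ∈ maximalIdeal R ^ 2, φ u ∈ I := by
    intro φ I hmul u hu
    rw [pow_two] at hu
    refine Submodule.mul_induction_on hu hmul fun u v hu hv => ?_
    rw [map_add]
    exact add_mem hu hv
  -- the family: lifts of a basis of `𝔪_A/𝔪_A²`, and `w`
  let wv : Option (Fin d) → maximalIdeal R := fun o =>
    o.elim ⟨w, hw⟩ fun i => ⟨algebraMap A R (x i), hloc _ (x i).2⟩
  have hwn : ((wv none : maximalIdeal R) : R) = w := rfl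
  have hws : ∀ i, ((wv (some i) : maximalIdeal R) : R) = algebraMap A R (x i) := fun i => rfl
  have hli : LinearIndependent (ResidueField R)
      fun o => (maximalIdeal R).toCotangent (wv o) := by
    rw [Fintype.linearIndependent_iff]
    intro g hg
    choose r hr using fun o => IsLocalRing.residue_surjective (g o)
    choose b hb using fun o => hsur (r o)
    -- `∑ r_o w_o ∈ 𝔪_R²`
    have hsumeq : (maximalIdeal R).toCotangent (∑ o, r o • wv o) =
        ∑ o, g o • (maximalIdeal R).toCotangent (wv o) := by
      rw [map_sum]
      refine Finset.sum_congr rfl fun o _ => ?_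
      rw [map_smul, ← hr o, ← IsLocalRing.ResidueField.algebraMap_eq, algebraMap_smul]
    have h1 : (∑ o, r o * (wv o : R)) ∈ maximalIdeal R ^ 2 := by
      have h := hsumeq.trans hg
      rw [Ideal.toCotangent_eq_zero] at h
      simpa only [Submodule.coe_sum, Submodule.coe_smul, smul_eq_mul] using h
    -- replace `r_o` by `b_o ∈ A`
    have h2 : (∑ o, algebraMap A R (b o) * (wv o : R)) ∈ maximalIdeal R ^ 2 := by
      have heq : ∀ o, algebraMap A R (b o) * (wv o : R) =
          r o * (wv o : R) - (r o - algebraMap A R (b o)) * (wv o : R) := fun o => by ring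
      simp_rw [heq, Finset.sum_sub_distrib]
      exact sub_mem h1 (Submodule.sum_mem _ fun o _ => by
        rw [pow_two]; exact Ideal.mul_mem_mul (hb o) (wv o).2)
    -- apply the coordinates
    have hφ0u : φ₀ (∑ o, algebraMap A R (b o) * (wv o : R)) = ∑ i, b (some i) * (x i : A) := by
      rw [map_sum, Fintype.sum_option, hwn, ← Algebra.smul_def, map_smul, h0w, smul_zero, zero_add]
      refine Finset.sum_congr rfl fun i _ => ?_
      rw [hws, ← Algebra.smul_def, map_smul, h00, smul_eq_mul]
    have hφ1u : φ₁ (∑ o, algebraMap A R (b o) * (wv o : R)) = b none := by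
      rw [map_sum, Fintype.sum_option, hwn, ← Algebra.smul_def, map_smul, h1w, smul_eq_mul,
        mul_one, add_eq_left]
      refine Finset.sum_eq_zero fun i _ => ?_
      rw [hws, ← Algebra.smul_def, map_smul, h10, smul_zero]
    have hbsome : ∀ i, b (some i) ∈ maximalIdeal A := by
      have hcot : (maximalIdeal A).toCotangent (∑ i, b (some i) • x i) = 0 := by
        rw [Ideal.toCotangent_eq_zero]
        simpa only [Submodule.coe_sum, Submodule.coe_smul, smul_eq_mul, hφ0u] using
          hφ φ₀ _ hmul0 _ h2
      have hlin : ∑ i, residue A (b (some i)) • bA i = 0 := by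
        rw [← hcot, map_sum]
        refine Finset.sum_congr rfl fun i _ => ?_
        rw [map_smul, hx, ← IsLocalRing.ResidueField.algebraMap_eq, algebraMap_smul]
      have hind := Fintype.linearIndependent_iff.mp bA.linearIndependent _ hlin
      intro i
      rw [← residue_eq_zero_iff]
      exact hind i
    intro o
    rw [← hr o, residue_eq_zero_iff]
    have hbo : b o ∈ maximalIdeal A := by
      cases o with
      | none => rw [← hφ1u]; exact hφ φ₁ _ hmul1 _ h2
      | some i => exact hbsome i
    simpa only [sub_add_cancel] using add_mem (hb o) (hloc _ hbo)
  have hcard := hli.fintype_card_le_finrank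
  simpa only [Fintype.card_option, Fintype.card_fin] using hcard

/-! ### Floor arithmetic -/

/-- For `j + k = p`, `0 < j < p`, `1 ≤ a < p` (`p` prime, so `p ∤ j a`):
`⌊j a/p⌋ + ⌊k a/p⌋ + 1 ≤ a`, i.e. the exponent of each `t_i` in `z_j z_{p-j}` is positive.
[folklore] -/
theorem konr_floor_add_floor_succ_le {p a j k : ℕ} (hp : p.Prime) (hjk : j + k = p)
    (hj0 : j ≠ 0) (hjp : j < p) (ha : 1 ≤ a ∧ a < p) : j * a / p + k * a / p + 1 ≤ a := by
  have hndvd : ¬ p ∣ j * a := by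
    intro hdvd
    rcases (Nat.Prime.dvd_mul hp).mp hdvd with h' | h'
    · exact absurd (Nat.le_of_dvd (Nat.pos_of_ne_zero hj0) h') (not_le.mpr hjp)
    · exact absurd (Nat.le_of_dvd ha.1 h') (not_le.mpr ha.2)
  have h1 : j * a / p * p < j * a := lt_of_le_of_ne (Nat.div_mul_le_self _ _)
    fun h => hndvd ⟨j * a / p, by rw [mul_comm p]; exact h.symm⟩
  have h3 : (j * a / p + k * a / p) * p < a * p := by
    calc (j * a / p + k * a / p) * p = j * a / p * p + k * a / p * p := add_mul _ _ _
      _ < j * a + k * a := add_lt_add_of_lt_of_le h1 (Nat.div_mul_le_self _ _)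
      _ = a * p := by rw [← add_mul, hjk, mul_comm]
  exact Nat.lt_of_mul_lt_mul_right h3

/-- Residues of a sum of two residues: for `j, k < p`, either `j + k < p` and
`(j + k) mod p = j + k`, or `p ≤ j + k` and `(j + k) mod p = j + k - p`. [folklore] -/
theorem konr_add_mod_cases {p j k : ℕ} (hj : j < p) (hk : k < p) :
    ((j + k) % p = j + k ∧ j + k < p) ∨ ((j + k) % p + p = j + k ∧ p ≤ j + k) := by
  by_cases h : j + k < p
  · exact Or.inl ⟨Nat.mod_eq_of_lt h, h⟩
  · replace h : p ≤ j + k := not_lt.mp h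
    refine Or.inr ⟨?_, h⟩
    rw [Nat.mod_eq_sub_mod h, Nat.mod_eq_of_lt (by omega)]
    omega

/-! ### The Kummer order is not regular over two charged components -/

/-- **The Kummer order over two charged boundary components is singular.** In the situation of
`stub_kummerOrderStructure` (`A` regular local with fraction field `K` of characteristic `p`,
`[L : K] = p`, `y ∈ L ∖ K`, `y^p = ∏ t_i^{a_i}`, `a₀ = 1`, `1 ≤ a_i < p`, `t_i ≠ 0`,
`z_j = y^j / ∏ t_i^{⌊j a_i/p⌋}`), if `t₀ ∈ 𝔪_A` and `t_{i₁} ∈ 𝔪_A` for some `i₁ ≠ 0`, then the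
Kummer order `A[z_0, …, z_{p-1}] ⊆ L` is not a regular local ring: its embedding dimension is at
least `dim A + 1 > dim A = dim R`. [folklore] -/
theorem stub_kummerOrderNotRegular {A K L : Type} [CommRing A] [IsRegularLocalRing A] [Field K]
    [Algebra A K] [IsFractionRing A K] [Field L] [Algebra K L] [Algebra A L] [IsScalarTower A K L]
    (p : ℕ) (hp : p.Prime) [CharP K p] (hdeg : Module.finrank K L = p) (m : ℕ)
    (t : Fin (m + 1) → A) (ht : ∀ i, t i ≠ 0) (a : Fin (m + 1) → ℕ) (ha0 : a 0 = 1)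
    (ha : ∀ i, 1 ≤ a i ∧ a i < p) (y : L) (hy : y ∉ Set.range (algebraMap K L))
    (hyp : y ^ p = algebraMap A L (∏ i, t i ^ a i)) (z : Fin p → L)
    (hz : ∀ j, z j = y ^ (j : ℕ) / algebraMap A L (∏ i, t i ^ ((j : ℕ) * a i / p)))
    (h0 : t 0 ∈ IsLocalRing.maximalIdeal A)
    (h1 : ∃ i : Fin (m + 1), i ≠ 0 ∧ t i ∈ IsLocalRing.maximalIdeal A) :
    ¬ IsRegularLocalRing (Algebra.adjoin A (Set.range z)) := by
  classical
  intro hreg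
  obtain ⟨hspanL, hliL, hfin, -, -⟩ :=
    stub_kummerOrderStructure p hp hdeg m t ht a ha0 ha y hy hyp z hz
  haveI : Fact p.Prime := ⟨hp⟩
  haveI : CharP L p := charP_of_injective_algebraMap (algebraMap K L).injective p
  have hinj : Function.Injective (algebraMap A L) :=
    algebraMap_injective_of_isFractionRing_tower K
  have hne : ∀ e : Fin (m + 1) → ℕ, algebraMap A L (∏ i, t i ^ e i) ≠ 0 := fun e => by
    rw [map_prod]
    exact Finset.prod_ne_zero_iff.mpr fun i _ => by
      rw [map_pow]; exact pow_ne_zero _ ((map_ne_zero_iff _ hinj).mpr (ht i))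
  have hzp : ∀ j, ∃ c : A, z j ^ p = algebraMap A L c := fun j => ⟨_, kummer_z_pow hyp hz hne j⟩
  let R : Subalgebra A L := Algebra.adjoin A (Set.range z)
  haveI : IsRegularLocalRing R := hreg
  haveI : Module.Finite A R := hfin
  haveI : Algebra.IsIntegral A R := Algebra.IsIntegral.of_finite A R
  -- the basis `zR` of `R`
  set zR : Fin p → R := fun j => ⟨z j, Algebra.subset_adjoin (Set.mem_range_self j)⟩ with hzRdef
  set j0 : Fin p := ⟨0, hp.pos⟩ with hj0def
  set j1 : Fin p := ⟨1, hp.one_lt⟩ with hj1def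
  have h01 : j0 ≠ j1 := fun h => by simpa [hj0def, hj1def] using congrArg Fin.val h
  have hz0 : zR j0 = 1 := Subtype.ext (kummer_z_zero hp hz)
  have hcomp : ((Subalgebra.val R).toLinearMap : R →ₗ[A] L) ∘ zR = z := funext fun j => rfl
  have hliR : LinearIndependent A zR :=
    LinearIndependent.of_comp ((Subalgebra.val R).toLinearMap : R →ₗ[A] L)
      (by rw [hcomp]; exact hliL)
  have hspR : ⊤ ≤ Submodule.span A (Set.range zR) := by
    rintro r -
    have hr : (r : L) ∈ Submodule.map ((Subalgebra.val R).toLinearMap : R →ₗ[A] L)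
        (Submodule.span A (Set.range zR)) := by
      rw [Submodule.map_span, ← Set.range_comp, hcomp, ← hspanL]
      exact r.2
    obtain ⟨r', hr', hr'eq⟩ := hr
    rwa [← (Subtype.val_injective hr'eq : r' = r)]
  let b : Module.Basis (Fin p) A R := Module.Basis.mk hliR hspR
  have hb : ∀ j, b j = zR j := fun j => Module.Basis.mk_apply hliR hspR j
  have hcoordz : ∀ l j, b.coord l (zR j) = if j = l then 1 else 0 := fun l j =>
    Module.Basis.mk_coord_apply
  -- units and nonunits
  have hloc : ∀ c ∈ maximalIdeal A, algebraMap A R c ∈ maximalIdeal R := by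
    intro c hc
    rw [mem_maximalIdeal, mem_nonunits_iff] at hc ⊢
    exact fun hu => hc (kummer_isUnit_of_isUnit_algebraMap hinj hzp hu)
  have hloc' : ∀ c : A, algebraMap A R c ∈ maximalIdeal R → c ∈ maximalIdeal A := fun c hc =>
    (mem_maximalIdeal _).mpr (mem_nonunits_iff.mpr fun hu =>
      mem_nonunits_iff.mp ((mem_maximalIdeal _).mp hc) (hu.map _))
  have ht0 : ¬ IsUnit (t 0) := mem_nonunits_iff.mp ((mem_maximalIdeal _).mp h0)
  have hzRmem : ∀ j : Fin p, (j : ℕ) ≠ 0 → zR j ∈ maximalIdeal R := by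
    intro j hj
    rw [mem_maximalIdeal, mem_nonunits_iff]
    exact kummer_not_isUnit_z hinj hyp hz hne ht0 (ha 0) hj
  -- `R = A + 𝔪_R` via the `z₀`-coordinate
  have hdecomp : ∀ r : R, r - algebraMap A R (b.coord j0 r) ∈ maximalIdeal R := by
    intro r
    have hsum := b.sum_repr r
    rw [← Finset.add_sum_erase _ _ (Finset.mem_univ j0)] at hsum
    have h0' : b.repr r j0 • b j0 = algebraMap A R (b.coord j0 r) := by
      rw [hb, hz0, Algebra.algebraMap_eq_smul_one]
      rfl
    rw [h0'] at hsum
    rw [sub_eq_of_eq_add' hsum.symm]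
    refine Submodule.sum_mem _ fun i hi => Submodule.smul_of_tower_mem _ _ ?_
    rw [hb]
    exact hzRmem i fun h => Finset.ne_of_mem_erase hi (Fin.ext h)
  have hc0 : ∀ r ∈ maximalIdeal R, b.repr r j0 ∈ maximalIdeal A := by
    intro r hr
    refine hloc' _ ?_
    have h := sub_mem hr (hdecomp r)
    rwa [sub_sub_cancel, Module.Basis.coord_apply] at h
  -- the multiplication table in `R`
  obtain ⟨ε, hε⟩ : ∃ ε : Fin p → Fin p → A, ∀ j k, ε j k =
      ∏ i, t i ^ (((j : ℕ) + k) * a i / p - j * a i / p - k * a i / p) := ⟨_, fun _ _ => rfl⟩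
  have hmulR : ∀ j k : Fin p,
      zR j * zR k = ε j k • zR ⟨((j : ℕ) + k) % p, Nat.mod_lt _ hp.pos⟩ := by
    intro j k
    apply Subtype.ext
    rw [Subalgebra.coe_mul, Subalgebra.coe_smul, Algebra.smul_def, hε]
    change z j * z k = _ * z ⟨((j : ℕ) + k) % p, Nat.mod_lt _ hp.pos⟩
    rw [hz j, hz k, kummer_generator_mul K p hp.pos t ht a y hyp, hz]
  have hcoordmul : ∀ l j k : Fin p, b.coord l (zR j * zR k) =
      if (⟨((j : ℕ) + k) % p, Nat.mod_lt _ hp.pos⟩ : Fin p) = l then ε j k else 0 := by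
    intro l j k
    rw [hmulR, map_smul, hcoordz, smul_eq_mul, mul_ite, mul_one, mul_zero]
  -- coefficients with a `z₀`-component lie in `𝔪_A²`
  have hε_sq : ∀ j k : Fin p, (j : ℕ) ≠ 0 → (j : ℕ) + k = p → ε j k ∈ maximalIdeal A ^ 2 := by
    intro j k hj hjk
    obtain ⟨i₁, hi₁0, hi₁⟩ := h1
    have hexp : ∀ i, 1 ≤ ((j : ℕ) + k) * a i / p - j * a i / p - k * a i / p := by
      intro i
      have h := konr_floor_add_floor_succ_le hp hjk hj j.2 (ha i)
      rw [hjk, Nat.mul_div_cancel_left _ hp.pos]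
      omega
    have hdvd : t 0 * t i₁ ∣ ε j k := by
      rw [hε]
      calc t 0 * t i₁ ∣ t 0 ^ (((j : ℕ) + k) * a 0 / p - j * a 0 / p - k * a 0 / p) *
            t i₁ ^ (((j : ℕ) + k) * a i₁ / p - j * a i₁ / p - k * a i₁ / p) :=
          mul_dvd_mul (dvd_pow_self _ (by have := hexp 0; omega))
            (dvd_pow_self _ (by have := hexp i₁; omega))
        _ = ∏ i ∈ ({0, i₁} : Finset (Fin (m + 1))),
            t i ^ (((j : ℕ) + k) * a i / p - j * a i / p - k * a i / p) :=
          (Finset.prod_pair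
            (f := fun i => t i ^ (((j : ℕ) + k) * a i / p - j * a i / p - k * a i / p))
            hi₁0.symm).symm
        _ ∣ ∏ i, t i ^ (((j : ℕ) + k) * a i / p - j * a i / p - k * a i / p) :=
          Finset.prod_dvd_prod_of_subset _ _ _ (Finset.subset_univ _)
    refine Ideal.mem_of_dvd _ hdvd ?_
    rw [pow_two]
    exact Ideal.mul_mem_mul h0 hi₁
  -- coefficients with a `z₁`-component (`j, k ≥ 1`) lie in `𝔪_A`
  have hε_one : ∀ j k : Fin p, (j : ℕ) + k = p + 1 → ε j k ∈ maximalIdeal A := by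
    intro j k hjk
    have he1 : ((j : ℕ) + k) * a 0 / p = 1 := by
      rw [ha0, mul_one, hjk, Nat.add_div_left _ hp.pos, Nat.div_eq_of_lt hp.one_lt]
    have he2 : (j : ℕ) * a 0 / p = 0 := by rw [ha0, mul_one]; exact Nat.div_eq_of_lt j.2
    have he3 : (k : ℕ) * a 0 / p = 0 := by rw [ha0, mul_one]; exact Nat.div_eq_of_lt k.2
    have hdvd : t 0 ∣ ε j k := by
      rw [hε]
      calc t 0 ∣ t 0 ^ (((j : ℕ) + k) * a 0 / p - j * a 0 / p - k * a 0 / p) := by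
            rw [he1, he2, he3, Nat.sub_zero, Nat.sub_zero, pow_one]
        _ ∣ ∏ i, t i ^ (((j : ℕ) + k) * a i / p - j * a i / p - k * a i / p) :=
          Finset.dvd_prod_of_mem
            (fun i => t i ^ (((j : ℕ) + k) * a i / p - j * a i / p - k * a i / p))
            (Finset.mem_univ 0)
    exact Ideal.mem_of_dvd _ hdvd h0
  -- termwise estimates
  have hT0 : ∀ (j k : Fin p) (c c' : Fin p → A), c j0 ∈ maximalIdeal A → c' j0 ∈ maximalIdeal A →
      c j * c' k * b.coord j0 (zR j * zR k) ∈ maximalIdeal A ^ 2 := by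
    intro j k c c' hc hc'
    rw [hcoordmul]
    split_ifs with hjk
    · have hjk' : ((j : ℕ) + k) % p = 0 := by simpa [hj0def] using congrArg Fin.val hjk
      by_cases hj : (j : ℕ) = 0
      · have hk : (k : ℕ) = 0 := by
          rcases konr_add_mod_cases j.2 k.2 with ⟨h1', h2'⟩ | ⟨h1', h2'⟩ <;> omega
        have hj' : j = j0 := Fin.ext hj
        have hk' : k = j0 := Fin.ext hk
        rw [hj', hk', pow_two]
        exact Ideal.mul_mem_right _ _ (Ideal.mul_mem_mul hc hc')
      · have hsum : (j : ℕ) + k = p := by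
          rcases konr_add_mod_cases j.2 k.2 with ⟨h1', h2'⟩ | ⟨h1', h2'⟩ <;> omega
        exact Ideal.mul_mem_left _ _ (hε_sq j k hj hsum)
    · rw [mul_zero]
      exact zero_mem _
  have hT1 : ∀ (j k : Fin p) (c c' : Fin p → A), c j0 ∈ maximalIdeal A → c' j0 ∈ maximalIdeal A →
      c j * c' k * b.coord j1 (zR j * zR k) ∈ maximalIdeal A := by
    intro j k c c' hc hc'
    rw [hcoordmul]
    split_ifs with hjk
    · have hjk' : ((j : ℕ) + k) % p = 1 := by simpa [hj1def] using congrArg Fin.val hjk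
      by_cases hj : (j : ℕ) = 0
      · have hj' : j = j0 := Fin.ext hj
        rw [hj']
        exact Ideal.mul_mem_right _ _ (Ideal.mul_mem_right _ _ hc)
      by_cases hk : (k : ℕ) = 0
      · have hk' : k = j0 := Fin.ext hk
        rw [hk']
        exact Ideal.mul_mem_right _ _ (Ideal.mul_mem_left _ _ hc')
      · have hsum : (j : ℕ) + k = p + 1 := by
          rcases konr_add_mod_cases j.2 k.2 with ⟨h1', h2'⟩ | ⟨h1', h2'⟩ <;> omega
        exact Ideal.mul_mem_left _ _ (hε_one j k hsum)
    · rw [mul_zero]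
      exact zero_mem _
  -- bilinear expansion of the coordinates of a product
  have hexpand : ∀ (l : Fin p) (c c' : Fin p → A),
      b.coord l ((∑ j, c j • zR j) * ∑ k, c' k • zR k) =
        ∑ j, ∑ k, c j * c' k * b.coord l (zR j * zR k) := by
    intro l c c'
    rw [Finset.sum_mul_sum, map_sum]
    refine Finset.sum_congr rfl fun j _ => ?_
    rw [map_sum]
    refine Finset.sum_congr rfl fun k _ => ?_
    rw [smul_mul_smul_comm, map_smul, smul_eq_mul]
  have hrepr : ∀ r : R, ∑ j, b.repr r j • zR j = r := fun r => by
    calc ∑ j, b.repr r j • zR j = ∑ j, b.repr r j • b j := by simp_rw [hb]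
      _ = r := b.sum_repr r
  have hmul : ∀ (l : Fin p) (I : Ideal A), (∀ (j k : Fin p) (c c' : Fin p → A),
      c j0 ∈ maximalIdeal A → c' j0 ∈ maximalIdeal A → c j * c' k * b.coord l (zR j * zR k) ∈ I) →
      ∀ r ∈ maximalIdeal R, ∀ r' ∈ maximalIdeal R, b.coord l (r * r') ∈ I := by
    intro l I hT r hr r' hr'
    rw [← hrepr r, ← hrepr r', hexpand]
    exact Submodule.sum_mem _ fun j _ => Submodule.sum_mem _ fun k _ =>
      hT j k _ _ (hc0 r hr) (hc0 r' hr')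
  -- values of the coordinates on `A` and on `w = z₁`
  have h00 : ∀ c, b.coord j0 (algebraMap A R c) = c := by
    intro c
    rw [Algebra.algebraMap_eq_smul_one, ← hz0, map_smul, hcoordz, if_pos rfl, smul_eq_mul, mul_one]
  have h10 : ∀ c, b.coord j1 (algebraMap A R c) = 0 := by
    intro c
    rw [Algebra.algebraMap_eq_smul_one, ← hz0, map_smul, hcoordz, if_neg h01, smul_zero]
  -- count dimensions: `edim A + 1 ≤ edim R = dim R ≤ dim A = edim A`
  have key := finrank_cotangentSpace_add_one_le_of_coord hloc (fun r => ⟨_, hdecomp r⟩)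
    (b.coord j0) (b.coord j1) h00 h10 (zR j1) (hzRmem j1 (by simp [hj1def]))
    (by rw [hcoordz, if_neg (Ne.symm h01)]) (by rw [hcoordz, if_pos rfl]) (hmul j0 _ hT0)
    (hmul j1 _ hT1)
  have hle : (Module.finrank (ResidueField R) (CotangentSpace R) : WithBot ℕ∞) ≤
      Module.finrank (ResidueField A) (CotangentSpace A) := by
    rw [(IsRegularLocalRing.iff_finrank_cotangentSpace R).mp hreg,
      (IsRegularLocalRing.iff_finrank_cotangentSpace A).mp inferInstance]
    exact Literature.RingTheory.KrullDimension.ringKrullDim_le_of_isIntegral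
  have hle' : Module.finrank (ResidueField R) (CotangentSpace R) ≤
      Module.finrank (ResidueField A) (CotangentSpace A) := by
    exact_mod_cast hle
  omega

end Summit.ResolutionOfSingularities.ResolutionOfSingularities.Theorems.RadicialJung.CleanModelsSuffice

end
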